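import Literature.Geometry.Riemannian.ParabolicGraphLimits
import Literature.Analysis.PDE.ParabolicHolderCompactness
import Mathlib.Analysis.Calculus.InverseFunctionTheorem.ApproximatesLinearOn
import Mathlib.Analysis.Calculus.MeanValue
import HarnessLib

/-!
# Re-graphing a parabolic graph over a nearby frame (set-level layer)

Topic `Literature/Geometry/Riemannian`.  Let `Y = (L x + u(x,t), t)` be the parabolic graph of
`u` over the isometric frame `L : ℝᵐ → ℝᴺ`, and let `L' : ℝᵐ → ℝᴺ` be another isometric frame (the
frame of a nearby plane `P`).  Writing `π = L'†` and `Q v = v - L' (π v)` (the components along `P`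
and `P^⊥`), the slice maps

  `Φ_t (x) = π (L x + u(x, t))`

are `C¹`-close to a fixed linear isomorphism `T` as soon as `‖π ∘ (L + D u(x,t)) - T‖ ≤ δ`
(`approximatesLinearOn_slice`).  For `δ < ‖T⁻¹‖⁻¹` Mathlib's quantitative inverse function theorem
(`ApproximatesLinearOn`) inverts every slice on the ball `B_R`, with image containing the closed
ball of radius `(‖T⁻¹‖⁻¹ - δ) R'` about `Φ_t 0` (`R' < R`).  The inverse `χ` defines the NEW graph
function `u' (ξ, t) = Q (L χ + u(χ, t))` over `L'`, `u' ⊥ range L'`, and the two parabolic graphs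
agree where both are defined (`exists_regraph`).

This is the set-level part of the re-graphing of the blow-up sequence over the frame of the
limit plane in the proof of White's Thm. 3.1 (2005, p. 1499: "by rotating we may assume
`P = ℝᵐ × (0)`"); the regularity and the Hölder bounds of `u'` are treated separately.

Everything is PROVED; no definitions, no named facts.

## References

* B. White, *A local regularity theorem for mean curvature flow*, Ann. of Math. 161 (2005), §2.5,
  p. 1499. [White2005]
-/

noncomputable section

open scoped Topology InnerProductSpace NNReal
open Filter

namespace Literature.Geometry.Riemannian

open Literature.Analysis.PDE Literature.Analysis.PDE.Parabolic Metric Set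

namespace ParabolicFlow

variable {N m : ℕ}

/-! ### The components along a frame and its orthogonal complement -/

/-- `v - L' (L'† v)` is orthogonal to `range L'`. [folklore] -/
theorem inner_sub_frame_eq_zero (L' : EuclideanSpace ℝ (Fin m) →ₗᵢ[ℝ] EuclideanSpace ℝ (Fin N))
    (v : EuclideanSpace ℝ (Fin N)) (η : EuclideanSpace ℝ (Fin m)) :
    ⟪v - L' (L'.toContinuousLinearMap.adjoint v), L' η⟫_ℝ = 0 := by
  rw [inner_sub_left, L'.inner_map_map, ContinuousLinearMap.adjoint_inner_left]
  simp

/-- `v = L' (L'† v) + (v - L' (L'† v))`. [folklore] -/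
theorem frame_add_sub_frame (L' : EuclideanSpace ℝ (Fin m) →ₗᵢ[ℝ] EuclideanSpace ℝ (Fin N))
    (v : EuclideanSpace ℝ (Fin N)) :
    L' (L'.toContinuousLinearMap.adjoint v) + (v - L' (L'.toContinuousLinearMap.adjoint v)) = v :=
  add_sub_cancel _ _

/-! ### The slice maps approximate a linear isomorphism -/

section Slice

variable (L L' : EuclideanSpace ℝ (Fin m) →ₗᵢ[ℝ] EuclideanSpace ℝ (Fin N))
  (u : Parabolic (EuclideanSpace ℝ (Fin m)) → EuclideanSpace ℝ (Fin N))

/-- **The slice maps `Φ_t = π ∘ (L + u(·,t))` approximate `T`** on the ball `B_R` with constant `δ`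
when `u` satisfies the guard on `B_R × {t}` and `‖π ∘ (L + D u(x,t)) - T‖ ≤ δ` there (mean value
inequality). [cite: White2005, §2.5] -/
theorem approximatesLinearOn_slice {W : Set (Parabolic (EuclideanSpace ℝ (Fin m)))}
    (hu : IsC21On u W) {R : ℝ} {t : ℝ}
    (hW : ∀ x ∈ ball (0 : EuclideanSpace ℝ (Fin m)) R, (⟨x, t⟩ : Parabolic _) ∈ W)
    (T : EuclideanSpace ℝ (Fin m) →L[ℝ] EuclideanSpace ℝ (Fin m)) {δ : ℝ≥0}
    (hδ : ∀ x ∈ ball (0 : EuclideanSpace ℝ (Fin m)) R,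
      ‖L'.toContinuousLinearMap.adjoint.comp (L.toContinuousLinearMap + spaceDeriv u ⟨x, t⟩) - T‖
        ≤ δ) :
    ApproximatesLinearOn
      (fun x => L'.toContinuousLinearMap.adjoint (L x + u ⟨x, t⟩)) T (ball 0 R) δ := by
  intro x hx y hy
  have hderiv : ∀ z ∈ ball (0 : EuclideanSpace ℝ (Fin m)) R,
      HasFDerivWithinAt (fun x => L'.toContinuousLinearMap.adjoint (L x + u ⟨x, t⟩))
        (L'.toContinuousLinearMap.adjoint.comp (L.toContinuousLinearMap + spaceDeriv u ⟨z, t⟩))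
        (ball 0 R) z := by
    intro z hz
    have h1 : HasFDerivAt (fun x => L x + u ⟨x, t⟩)
        (L.toContinuousLinearMap + spaceDeriv u ⟨z, t⟩) z :=
      L.toContinuousLinearMap.hasFDerivAt.add (hu.hasFDerivAt_space (hW z hz))
    exact (L'.toContinuousLinearMap.adjoint.hasFDerivAt.comp z h1).hasFDerivWithinAt
  exact (convex_ball (0 : EuclideanSpace ℝ (Fin m)) R).norm_image_sub_le_of_norm_hasFDerivWithin_le'
    hderiv hδ hy hx

end Slice

/-! ### Re-graphing -/

section ReGraph

variable (L L' : EuclideanSpace ℝ (Fin m) →ₗᵢ[ℝ] EuclideanSpace ℝ (Fin N))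
  (u : Parabolic (EuclideanSpace ℝ (Fin m)) → EuclideanSpace ℝ (Fin N))

/-- **Re-graphing over a nearby frame (set level).**  Suppose every slice map
`Φ_t = L'† ∘ (L + u(·,t))`, `t ∈ I`, approximates the linear isomorphism `T` on `B_R` with constant
`δ < ‖T⁻¹‖⁻¹`, and `0 ≤ R' < R`.  Then there are `χ` (the slice-wise inverse) and the new graph
function `u' = (L χ + u ∘ (χ, t)) - L' L'† (…)` over `L'`, orthogonal to `range L'`, such that:
`χ` inverts `Φ_t` on `B_R`; every `ξ` in the closed ball of radius `(‖T⁻¹‖⁻¹ - δ) R'` about `Φ_t 0`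
has `χ (ξ, t) ∈ B_R` and `Φ_t (χ (ξ, t)) = ξ`; and the old graph point over `(x, t)` is the new
graph point over `(Φ_t x, t)`. [cite: White2005, §2.5, p. 1499] -/
theorem exists_regraph (T : EuclideanSpace ℝ (Fin m) ≃L[ℝ] EuclideanSpace ℝ (Fin m)) {δ : ℝ≥0}
    (hδ : δ < ‖(T.symm : EuclideanSpace ℝ (Fin m) →L[ℝ] EuclideanSpace ℝ (Fin m))‖₊⁻¹)
    {R R' : ℝ} (hR' : 0 ≤ R') (hRR' : R' < R) (I : Set ℝ)
    (happ : ∀ t ∈ I, ApproximatesLinearOn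
      (fun x => L'.toContinuousLinearMap.adjoint (L x + u ⟨x, t⟩))
      (T : EuclideanSpace ℝ (Fin m) →L[ℝ] EuclideanSpace ℝ (Fin m)) (ball 0 R) δ) :
    ∃ χ : Parabolic (EuclideanSpace ℝ (Fin m)) → EuclideanSpace ℝ (Fin m),
    ∃ u' : Parabolic (EuclideanSpace ℝ (Fin m)) → EuclideanSpace ℝ (Fin N),
      (∀ Ξ η, ⟪u' Ξ, L' η⟫_ℝ = 0) ∧
      (∀ Ξ, u' Ξ = (L (χ Ξ) + u ⟨χ Ξ, Ξ.t⟩) -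
        L' (L'.toContinuousLinearMap.adjoint (L (χ Ξ) + u ⟨χ Ξ, Ξ.t⟩))) ∧
      (∀ t ∈ I, ∀ x ∈ ball (0 : EuclideanSpace ℝ (Fin m)) R,
        χ ⟨L'.toContinuousLinearMap.adjoint (L x + u ⟨x, t⟩), t⟩ = x) ∧
      (∀ t ∈ I, ∀ ξ ∈ closedBall (L'.toContinuousLinearMap.adjoint (L 0 + u ⟨0, t⟩))
          (((‖(T.symm : EuclideanSpace ℝ (Fin m) →L[ℝ] EuclideanSpace ℝ (Fin m))‖₊ : ℝ)⁻¹ - δ) *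
            R'),
        χ ⟨ξ, t⟩ ∈ ball (0 : EuclideanSpace ℝ (Fin m)) R ∧
        L'.toContinuousLinearMap.adjoint (L (χ ⟨ξ, t⟩) + u ⟨χ ⟨ξ, t⟩, t⟩) = ξ) ∧
      (∀ t ∈ I, ∀ x ∈ ball (0 : EuclideanSpace ℝ (Fin m)) R,
        (⟨L x + u ⟨x, t⟩, t⟩ : Parabolic (EuclideanSpace ℝ (Fin N))) =
          ⟨L' (L'.toContinuousLinearMap.adjoint (L x + u ⟨x, t⟩)) +
            u' ⟨L'.toContinuousLinearMap.adjoint (L x + u ⟨x, t⟩), t⟩, t⟩) := by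
  classical
  set π := L'.toContinuousLinearMap.adjoint with hπ
  set Φ : ℝ → EuclideanSpace ℝ (Fin m) → EuclideanSpace ℝ (Fin m) :=
    fun t x => π (L x + u ⟨x, t⟩) with hΦ
  have hc : ∀ t ∈ I, Subsingleton (EuclideanSpace ℝ (Fin m)) ∨
      δ < ‖(T.symm : EuclideanSpace ℝ (Fin m) →L[ℝ] EuclideanSpace ℝ (Fin m))‖₊⁻¹ :=
    fun _ _ => Or.inr hδ
  -- the slice-wise inverse (junk outside `I`)
  set χ : Parabolic (EuclideanSpace ℝ (Fin m)) → EuclideanSpace ℝ (Fin m) := fun Ξ =>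
    if ht : Ξ.t ∈ I then
      ((happ Ξ.t ht).toOpenPartialHomeomorph (Φ Ξ.t) (ball 0 R) (hc Ξ.t ht) isOpen_ball).symm Ξ.x
    else 0 with hχ
  set u' : Parabolic (EuclideanSpace ℝ (Fin m)) → EuclideanSpace ℝ (Fin N) := fun Ξ =>
    (L (χ Ξ) + u ⟨χ Ξ, Ξ.t⟩) - L' (π (L (χ Ξ) + u ⟨χ Ξ, Ξ.t⟩)) with hu'
  have hleft : ∀ t ∈ I, ∀ x ∈ ball (0 : EuclideanSpace ℝ (Fin m)) R, χ ⟨Φ t x, t⟩ = x := by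
    intro t ht x hx
    simp only [hχ, dif_pos ht]
    exact ((happ t ht).toOpenPartialHomeomorph (Φ t) (ball 0 R) (hc t ht) isOpen_ball).left_inv
      (by simpa using hx)
  have hright : ∀ t ∈ I, ∀ ξ ∈ closedBall (Φ t 0)
      (((‖(T.symm : EuclideanSpace ℝ (Fin m) →L[ℝ] EuclideanSpace ℝ (Fin m))‖₊ : ℝ)⁻¹ - δ) * R'),
      χ ⟨ξ, t⟩ ∈ ball (0 : EuclideanSpace ℝ (Fin m)) R ∧ Φ t (χ ⟨ξ, t⟩) = ξ := by
    intro t ht ξ hξ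
    set e := (happ t ht).toOpenPartialHomeomorph (Φ t) (ball 0 R) (hc t ht) isOpen_ball with he
    have htarget : ξ ∈ e.target :=
      (happ t ht).closedBall_subset_target (hc t ht) isOpen_ball hR'
        (closedBall_subset_ball hRR') hξ
    have hχξ : χ ⟨ξ, t⟩ = e.symm ξ := by simp only [hχ, he, dif_pos ht]
    refine ⟨?_, ?_⟩
    · have := e.map_target htarget
      rwa [hχξ]
    · rw [hχξ]
      exact e.right_inv htarget
  refine ⟨χ, u', fun Ξ η => inner_sub_frame_eq_zero L' _ η, fun Ξ => rfl, hleft, hright,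
    fun t ht x hx => ?_⟩
  have h1 : χ ⟨π (L x + u ⟨x, t⟩), t⟩ = x := hleft t ht x hx
  ext1
  · show L x + u ⟨x, t⟩ = L' (π (L x + u ⟨x, t⟩)) + u' ⟨π (L x + u ⟨x, t⟩), t⟩
    simp only [hu']
    rw [h1]
    exact (frame_add_sub_frame L' _).symm
  · rfl

end ReGraph

end ParabolicFlow

end Literature.Geometry.Riemannian
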